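import Literature.MathematicalPhysics.QuantumFieldTheory.Balaban1983to89.B11SectG
import Literature.MathematicalPhysics.QuantumFieldTheory.Balaban1983to89.B11Eq181Covariance

/-!
# `Balaban1983to89.B11Carve16SectGHyp` — [Balaban1985Variational] Sect. G «Analyticity and an Expansion of U_k», pp. 305–309
# (displays (170)–(190), Proposition 9) CARVED IN HYPOTHESIS FORM — the residual printed statements of these five pages that
# had no declaration, and ONE bundle `B11Carve16SectGHyp.Hyp` conjoining the section's printed statements BY NAME
# (P6 carving fan, block 16; key item stmt-QuantumFields-20541, also feeds 20520, 20543)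

statement-level skeleton of published theorems with citation tags; proofs where landed; nothing here is a claim about the Yang–Mills mass gap

CITATION HEADER.  T. Bałaban, *The variational problem and background fields in renormalization group method for lattice gauge
theories*, Commun. Math. Phys. **102** (1985) 277–309, doi:10.1007/bf01229381 [Balaban1985Variational] (cell paper B11; its
references [3] = [Balaban1984PropagatorsII] (Lemma 2.1), [4] = [Balaban1985Averaging], [5] = [Balaban1985BackgroundPropagators],
[6] = [Balaban1985RegularSpaces]).  PDF held: `paper:balaban1985-cmp102-variational-background` (journal page = PDF page + 276);
pp. 305–309 = PDF 29–33 READ FIRST-HAND AS IMAGES on the renders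
`pub-balaban/b2b-balaban-ref1/pages/1985-cmp102-variational-background/…-p029…p033-x2.png` by this seat (2026-08-28); the locators
«`p00NN.txt:Ln`» below are line numbers of the `lit read` text layer of PDF page NN (the convention of `carve/CARVE-LIST.md` and of the
check referees; displays are garbled there and were read on the renders), «p. J l. n» the same line on journal page J.  The paper
is a MANUSCRIPT UNDER ADJUDICATION in this tree: every `def …Printed : Prop` below is a PRINTED statement typed as a proposition to
be used as a HYPOTHESIS `(h : …)`; every `theorem` is kernel-checked bookkeeping between typed forms, real arithmetic of printed
constants, or (§3) an abstract group-action lemma proved from Mathlib.  WHAT IS REPRODUCED = SKELETON rows B11.Prop9, B11.Eq170,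
Eq172, Eq174, Eq178, Eq181, Eq182, Eq185, Eq189, Eq190, Claim@309 (all IN TREE — cited, not restated) plus the residual sentences
listed under WHAT THIS FILE ADDS.  Unit `lit-balaban-carve-16` (HOME `run/shared/lean/pub/lit-balaban/carve/`, rules
`carve/CARVE-RULES.md`, block table `carve/BLOCKS-11-20.md` § Block 16); imports `…B11SectG` (hence `…B11`, `…B6RandomWalk`) and
`…B11Eq181Covariance` only; nothing in the tree is edited; off-limits stems (`Node00/*`, `T3*`, `T4*`, `B11Thm1*`, `B11Leaf*`) are
cited at most, never declared into.

## IN TREE = CITED (the printed items of pp. 305–309 that already have declarations; NOT restated here)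

* p. 305 `p0029.txt:L6–12`, the programme of Sect. G («U_k = U_k(V) … is an analytic function of V in the following sense: if
  V = V′V₀, V′ small, U₀ = U_k(V₀), and if we fix a gauge condition for U_k(V′V₀)U₀⁻¹, then it is an analytic function of
  B = 1/i log V′ and it has an expansion as a power series in B»): Proposition 9 itself — `B11.Prop9Printed` (B11.lean:410) over the
  Sect. G carrier `B11.AnData` (fields `ExtAnalytic`, `ExtOrbits`, `HDet`, `HAnalytic`, `HIn19_21`, `dH`); the chart 𝓗 AS A FUNCTION
  with «analytic function of B»: `B11Eq174Chart.chartH` / `chartHB`, `chartH_differentiableOn`, `B11Eq183Differentiation.analyticOnNhd_chartH179`;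
  the composition «analytic in B = (1/i) log V′ ⇒ analytic in V′»: `B11SectGAnalyticV.analyticAt_logCfg`, `analyticOnNhd_U1_of_V`,
  `analyticOnNhd_axial_of_V`; INHABITED for the model family: `B11Prop9Model.prop9Printed_model` (non-vacuity `B11Prop9ModelNonVacuity`).
* p. 305 `L13–19`, (170)–(171) (row B11.Eq170, PROVED): `B11Eq171Criticality.criticality_iff_adj_eq_zero` ((170) ⇔ (171)),
  `B11Eq177FirstOrder.eq170`, `eq170_of_isCritical82`, `eq170_of_isLocalMinOn_74`, `frakG_J_eq_zero_of_171` (𝔊J = 0 at U₀ = U_k, which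
  is why (175) has no 𝔊J term).
* p. 305 `L20–22`, (172) «|V′ − 1| < C₁ε₁, hence V′ = e^{iB′}, |B′| < 2C₁ε₁ on 𝔅_k, (172) for ε₁ sufficiently small» (row B11.Eq172,
  PROVED): `B11Eq172LogBound.eq172` (smallness C₁ε₁ ≤ ½ explicit), `B11SectGAnalyticV.eq172_cfg`, `norm_logCfg_lt`.
* p. 305 `L22–28`, the pair U_k(V′V₀), U₀ = U_k(V₀), «We repeat the whole procedure of Sects. A–E for this pair», the Landau gauge
  U₁ = exp iη𝓗(B) and (173) «𝓗 satisfies the conditions (19)–(21) with ε₂ = B₁(B₃(1 + 4C₁)ε₁ + C₁ε₁) ≤ 6B₁B₃C₁ε₁ = B₅ε₁»: the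
  arithmetic `B11.ineq173` (B11.lean:516, PROVED); the (19)–(21) clause = `B11.Prop9Printed`'s `HIn19_21 (B₅ε₁)` (model:
  `B11Prop9Model.norm_chart_lt`, `hIn19_21_model`); the Landau gauge of the pair via [6] Thm 2: `B11.p280_landau_gauge_of_B8Thm2`,
  `B11.Prop2Printed`.  The constant B₅ itself had no name in the tree — § WHAT THIS FILE ADDS, `constB5`.
* p. 305 `L29–33` + p. 306 `p0030.txt:L2–6`, (174)–(175), «The function on the right-hand side of (174) is an analytic function of
  𝒜₁ + H₁B … generated by Eq. (56) … The function 𝒜₁, as a solution of Eq. (175), is an analytic function of H₁B, hence of B … a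
  recursive system of equations» (row B11.Eq174, typed-existing carrier + PROVED pieces): `B11.AnData.HDet`; `B11Eq174Chart.solA`,
  `solA_spec`, `eq175`, `chartH_eq174`, `solA_differentiableOn`; `B11Prop6Scheme.solution_analytic` ((175) = `mapT` with J = 0);
  `B11.Prop3Printed` (the map (47) «defined and analytic», (56)); the letters of (174) on the lattice: `B11Eq103H1Complex.chartOfLetters`,
  `B11Eq117ChartLettersOnModel.exists_norm_chartLetters_le`.  The clause «𝒜₁ satisfies … the regularity conditions (19) with
  ε₂ = 8B₅ε₁» (`L33`) is the uniqueness regime ε₄ = 8ε₂ of p. 296 at ε₂ = B₅ε₁: `B11.Prop6Printed` (the solution in the space (115)),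
  `B11.axial_critical_from_one_landau` (ε₄ = 8ε₂), `B11Eq174Chart.Regime` / `B11Eq118RegimeRadii.exists_twoRegimes_radii` — HONEST SCOPE (iii).
* p. 306 `L6–10`, (176)–(177) «it begins with a term of second order in H₁B … the expansion of 𝓗 begins with the first order term
  H₁B … We can generate this way terms of an arbitrary order» (PROVED pieces): `B11Eq176Expansion.norm_solution_le_sq`,
  `norm_solution_add_le`, `norm_solution_add_quadratic_le` ((176)); `B11Eq177FirstOrder.hasFDerivAt_chartH177_zero`,
  `expansion_firstOrder` ((177) first order); `B11Eq177SecondOrder.norm_chartH_sub_secondOrder_le` ((177) second order);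
  `B11Eq177CriticalFamilyDerivative.fderiv_criticalFamily_eq_linearisedMinimiser`; all orders = analyticity (`B11Eq174Chart.chartH_differentiableOn`,
  `B11StarDecay190`).
* p. 306 `L11–16`, (178) «or P₀*(U_k)J = 0» (row B11.Eq178, PROVED): `B11Eq177FirstOrder.eq178`, `B11Eq171Criticality.criticality_iff_adj_eq_zero`
  (with T = ker Q); `L17–21` «a more general and natural condition … we can use the averaging operations Q̃ instead of Q, or mix
  these operations» is commentary (the abstract `criticality_iff_adj_eq_zero` is stated for an arbitrary tangent space T) — not typed separately.
* p. 306 `L21–28`, (179), the unnumbered equation «obtained from (143)», «defining G = (Δ_a − Δ^{(2)})⁻¹. From the estimate (3.137)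
  it follows that Δ^{(2)} is a small perturbation of Δ_a, and the new operator G has exactly the same properties as Δ_a⁻¹» and (180):
  `B6RandomWalkHom.b11_newG_entry1_of_3137`, `b11_newG_leftEntry_of_3137` (sup-type entries PROVED; second-order entries by analogy,
  cell GAPS G-B11-G1); `B11Eq183Differentiation.solA180`, `chartH179`, `eq180`, `mapT_180`; the (143)-form with its Λ-slot:
  `B11Prop6Scheme.conditions_143`, `B11Eq143LinearTermRadii.exists_regime_radii_linear_of_le`, `B11Eq79LinearTerm.LJ`.
* p. 306 `L29–32` «(180) is an equation of the same type as (175), and it has the same analyticity properties … the corresponding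
  formulas (176), (177). The advantage is that the operators in (180) have better regularity properties»: `B11Prop6Scheme.solution_analytic`,
  `B11Eq183Differentiation.analyticOnNhd_solA180`, `B11Eq177FirstOrder.solA180_zero`, `fderiv_solA180_zero`,
  `hasFDerivAt_chartH179_zero` ((176)–(177) for (180)); «better regularity» is commentary.
* p. 306 `L33` – p. 307 `p0031.txt:L8` «Independently of the representation chosen, the function 𝓗(B) is an analytic function of
  𝔤ᶜ-valued configurations B defined on 𝔅_k and satisfying (172) … we transform the configuration in the Landau gauge back to the
  axial gauge. This transformation is an analytic function of 𝓗, hence of B … U_k(V′V₀). It is an analytic function of V′, for V′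
  with values in a small neighborhood of the identity in Gᶜ, and for V′ with values in G it coincides with the minimal configuration
  constructed in the previous sections»: `B11.Prop9Printed`'s clauses `HAnalytic (2C₁ε₁)` and `ExtAnalytic (C₁ε₁)` («has an extension»
  = coincides where defined); `B11Prop9Model.hAnalytic_model`, `extAnalytic_model`; `B11SectGAnalyticV.analyticOnNhd_axial_of_V`,
  `analyticOnNhd_axial_of_V_pair`; both representations: `B11Presentation190` (the `hmv` letters for (174)–(175) and (179)–(180)).
* p. 307 `L9–16`, (181) «U_k(V^v) = U_k(V)^{v̄} … v̄ is constant on blocks Bʲ(y), y ∈ Λ_j, and equal to v(y). This equality extends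
  by analyticity …» (row B11.Eq181, PROVED pieces + carrier): `B11Eq181Covariance.minimiser_smul`, `isMinOn_smul_iff`,
  `min_value_smul` (G-valued v); `B11Eq181AnalyticExtension.eq181_extends_by_analyticity`, `eqOn_of_eqOn_realPoints` (the two
  «by analyticity» steps = the real-slice identity principle); the lift v ↦ v̄: `B15Eq177GaugeInvariance.blockLift`,
  `toMS_blockLift_self` (and its torus hypothesis form `B15Eq177GaugeInvariance.Cov181`); carrier clause `B11.AnData.ExtOrbits`;
  `B11AxialTransport190.axialRatio_eq_relAct`, `transport_formula`.  The sentences `L16–20` (definition on all orbits, analyticity on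
  the union, (181) there) had NO declaration (`B11Eq181AnalyticExtension` header (M3): «definitional and not typed») — § WHAT THIS FILE ADDS.
* p. 307 `L21–31`, «this derivative has regularity and decay properties identical to the propagator H, or H₀ … satisfies a linear
  equation obtained by differentiations», (182) «where the last scalar product is with respect to bonds in Ω₀ in η-scale» (row
  B11.Eq182, PROVED): `B11SectG.Eq182` (typed shape; the η-scale pairing = composition with 𝔇(𝒜₀ + H₀B), said in its docstring),
  `B11Eq183Differentiation.hasFDerivAt_chartH179_eq182`, `fderiv_chartH179_eq182`, `eq182_sectG`; `B11KernelDictionary.eq182_lift`.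
* p. 307 `L31–38`, (183), «Let us denote 𝔄₀(b, c) = (δ/δB(c))𝒜₀(B, b). We may fix a bond c ∈ 𝔅_k …», (184) «treated as a kernel of a
  linear operator»: `B11SectG.Eq184`, `B11Eq183Differentiation.eq183`, `eq184`, `eq184_sectG`; `B11KernelDictionary.eq184_lift`.
* p. 308 `p0032.txt:L2–17`, (185) with «r = max{|A′|_{(−1)}, |∇A′|_{(−2)}}(max{|𝔄|_{(−1)}, |∇𝔄|_{(−2)}})⁻¹», (186) «we get from
  Proposition 4», (187) «≤ O(1)B₀C₄B₅ε₁ max{…} for ε₁ sufficiently small, hence the norm of the linear operator is small also», (188)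
  «can be solved by the Neumann series expansion» (row B11.Eq185, PROVED): `B11Eq185SecondDerivative.secondDeriv_eq_fderiv`,
  `secondDeriv_eq_circleIntegral` ((185)), `norm_secondDeriv_le_of_radius`, `ineq186` (from Prop. 4, printed r and 4C₄ε₃), `ineq187`,
  `opNorm_le_of_187`, `eq188_solution`, `eq188_unique`, `eq188_neumann_series`, `existsUnique_184_of_187`; `B11SectG.Bound188`, `thetaK`,
  `qG` (the LOCATED smallness q < 1 of (187)), `neumann_telescope`, `neumann_majorant`; `B11Eq183Differentiation.norm_comp_fderiv_lt_one`,
  `isInvertible_184`, `eq188`, `bound188_sectG`; `B11Ineq190Actual.M0_sectG_nonneg`; `B11.Prop4Printed`.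
* p. 308 `L18–28`, the author's omission paragraph and (189) (row B11.Eq189, typed-existing — AUTHOR-OMITTED PROOF, cell GAPS G-B11-G2):
  `B11SectG.Ineq189` (the typed shape at one kernel), the supplied term census `B11Ineq189.HasMaj₂`, `d2D_shape`, `d2D_hasMaj₂`,
  `term189_of_d2D`, `ineq189_of_terms` (+ `B11Ineq189Census`, `B11Ineq189LocalLeaf`, `B11Ineq189Transpose*`, `B11Ineq189D2DDecayConcrete`);
  model leaf `B11Prop9Model.SectGDatum.Letters.maj189`.  Its printed binders «for … A′ satisfying (77)» with the constant «O(1)ε₃» are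
  typed here ON the row decl — § WHAT THIS FILE ADDS, `Ineq189ForallPrinted` (a slot of the bundle, since the row is typed, not proved).
* p. 308 `L29–35`, (190) «This inequality, the formula (188) and Lemma 2.1, and finally Proposition 2 and (181), yield … for x ∈ Δ(y),
  or supp ζ ⊂ Δ̃(y), y ∈ Λ_j, y′ ∈ Λ_{j′}» (row B11.Eq190, PROVED from (189) and the kernel letters): `B11SectG.Ineq190`, `ineq190_of_189`
  (entries 1–2, rate ⅛δ₀ DERIVED), `A0_strong_of_184`, `ineq190_strong_of_189` (entries 3–5), `const190`; `B11.pref190`, `B11.Prop9Printed`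
  (last clause, `dH`); `B11Ineq190Actual.ineq190_sectG`, `ineq190_strong_sectG`, `ineq190_sectG_dom` (for the ACTUAL Fréchet derivative);
  `B11Prop9Model.ineq190_model`, `dH_le`; the output sizes `B11SupSize190.supSize`, `B11SeminormSize190.ofSeminorms`, `covDerivBlockSize`;
  presentations `B11Presentation190.ineq190_presentation_chartH179`; Sect. C letters discharged `B11Ineq190FromProp3`, `B11Ineq190ConcreteC`,
  `B11Ineq190DerivConcreteC`, `B11Ineq73HasMajConcrete`, `B11HKernelHasMajConcrete`; the words «and finally Proposition 2 and (181)»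
  (transport from the Landau to the axial gauge / to a general base point): `B11AxialTransport190.ineq190_transport`, `far_bound`,
  `ineq190_axial_of_landau`, `B11Reparam190.ineq190_reparam` (cell GAPS G-B11-G2a for what remains by reference).
* p. 308 `L36` – p. 309 `p0033.txt:L6`, the U-dependence «These functions and operators can be extended to arbitrary, regular
  configurations U … They are analytic functions of these configurations … and the equations determine an analytic function 𝓗. All
  the above considerations and properties are valid for this function also» (row B11.Claim@309, PROVED at scheme level):
  `B11Claim309UAnalytic.analyticAt_solA`, `analyticOnNhd_solA`, `analyticOnNhd_chartH`, `analyticOnNhd_chartH_pair`; clause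
  «also of the external gauge field configuration U» of `B11.Prop9Printed`'s `HAnalytic` docstring.
* p. 309 `L7–16`, «Let us formulate the results of this section.» PROPOSITION 9 (row B11.Prop9, typed-existing): `B11.Prop9Printed
  (B₅ C₁ β₀ δ₀) fam` — THE slot of the bundle; its model instance `B11Prop9Model.prop9Printed_model` / `_of_le`; node-side readers
  `Node00/CarriersZSectG` (`SectGPres`, cited only), `B11LeafKnitProp9.prop9_conjunct_of_model`; the regularity vocabulary «(3.35)–(3.38)
  [5], or (1.7)–(1.9) [6]»: `B9.*` Sect. 3 carriers, `B8.GFData`, `B11Reg910Classes.Reg910Cube.reg336Cube`.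

## WHAT THIS FILE ADDS (residual printed sentences with no declaration; hypothesis form; kernel bookkeeping; the bundle)

* `constB5 B₁ B₃ C₁ := 6B₁B₃C₁` — p. 305 `L27–28` «≤ 6B₁B₃C₁ε₁ = B₅ε₁. (173) We assume that C₁ is an absolute constant, hence B₅ is
  such a constant also»: print's VALUE of the constant B₅ that `B11.Prop9Printed` takes as a parameter fixed before the family (the
  tree had only the model's `B11Prop9Model.B5 = 2(λ + α)` with `prop9Printed_model_of_le` for «any larger B₅, e.g. print's 6B₁B₃C₁»);
  `eps2_le_constB5_mul` = row B11.Eq172's `B11.ineq173` read with the named constant.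
* `Ineq189ForallPrinted bN b3 nMax d2V δ₀` — (189) WITH ITS PRINTED BINDERS (p. 308 `L24–28` «≤ O(1)ε₃ … for supp 𝔄 ⊂ Δ̃(y′), A′
  satisfying (77), y ∈ Λ_j», p. 307 `L37–38` «For a configuration A′ satisfying (77) with ε₃ sufficiently small»): ∃ O(1), a₃ before
  ε₃ ≤ a₃ and before A′ with max{|A′|_{(−1)}, |∇A′|_{(−2)}} < ε₃, the ROW DECL `B11SectG.Ineq189 bN b3 (d2V A′) (O(1)·ε₃) δ₀` — i.e. the
  typed-existing row under print's quantifier clause and with the printed ε₃-linearity of the constant, not a competing restatement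
  (`Ineq189ForallPrinted.on_ball` recovers the one-θ_W-on-the-ball shape of the model leaf `SectGDatum.Letters.maj189`; `at_le`,
  `ineq189_mono`).  NOT proved (author-omitted; G-B11-G2).
* `orbitUnion Γ dom`, `Cov181OnDomPrinted Γ dom Uk`, `orbitExt Γ dom Uk`, `OrbitExtensionPrinted Γ dom Uk` with the theorems
  `cov181OnDom_of_minimiser` (JUNCTION: `B11Eq181Covariance.minimiser_smul` ⇒ (181) on any domain), `orbitExt_apply_of_smul_mem`,
  `orbitExt_eq_of_mem` / `orbitExt_eqOn`, `orbitExt_smul`, `eqOn_orbitExt_of_covariant`, `isOpen_orbitUnion`, `analyticOnNhd_orbitExt`,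
  `orbitExtensionPrinted_of_cov181OnDom` — p. 307 `L14–20`: «we can prove the equality (181) for all these v for which V^v is in the
  analyticity domain of U_k» (HYPOTHESIS FORM `Cov181OnDomPrinted`, the conclusion of the two proved in-tree steps) and «We can extend
  it to all Gᶜ-valued v treating the equality as a definition for the remaining v. Thus U_k(V) is defined on all orbits of the group of
  Gᶜ-valued transformations, which contain elements V = V′V₀ described before. It is an analytic function on the union of the set of
  orbits, and it satisfies (181).» (HYPOTHESIS FORM `OrbitExtensionPrinted` = ∃ an extension that agrees with U_k on the domain,
  satisfies (181) on the union of orbits and is analytic there — AND PROVED from `Cov181OnDomPrinted` + analyticity of U_k on the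
  open domain + analyticity of the two actions, with the explicit witness `orbitExt` and its uniqueness `eqOn_orbitExt_of_covariant`).
  Abstract level (Mathlib group action on complex normed spaces), matching the level of the in-tree rows B11.Eq181
  (`B11Eq181Covariance`: abstract action; `B11Eq181AnalyticExtension`: coordinates ℂⁿ).
* `Hyp` (full name `…B11Carve16SectGHyp.Hyp`, a `structure … : Prop`) — THE BUNDLE keyed to the consumer: fields `prop9 :
  B11.Prop9Printed B₅ C₁ β₀ δ₀ fam` (Proposition 9 BY NAME), `ineq189 : Ineq189ForallPrinted bN b3 nMax d2V δ₀` (same δ₀), `cov181 :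
  Cov181OnDomPrinted Γ dom Uk`, `orbitExt : OrbitExtensionPrinted Γ dom Uk`; constructor `Hyp.of_cov181OnDom` (the last field derived),
  accessors `Hyp.ineq189_on_ball`, `Hyp.orbitExt_unique`.  The PROVED rows of the block need no slot (list above).

## HONEST SCOPE / NOT TYPED / MODELLING

(i) CARRIERS.  Proposition 9 enters on its carrier of record `B11.AnData` (indexed family, constants before the index as in `…B11`).
(189) enters on the block-size vocabulary of its row decl (`B11SectG.BlockNorm`, `HasMaj` over a `B6.Geometry`), for the kernel family
`d2V : FA → (FA →ₗ[ℝ] F3)` («treated as a kernel of a linear operator», p. 307) and the size `nMax` of (77) of ONE background,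
supplied as explicit parameters (model-supplied letters, the species of `B9Carve06Thms31to34Hyp.Thm34CinvRPrinted`'s predicates):
print's O(1) is absolute while here it is bound per datum — weaker than print as a hypothesis, never stronger (the family-uniform
constant lives in `B11Prop9Model.GConsts.θW`).  The orbit statements enter over an abstract action of a group `Γ` (the Gᶜ-valued gauge
transformations on 𝔅_k) on complex normed spaces `X` ∋ V (data) and `Y` ∋ U (configurations; the action through the block-constant
lift v̄) — the coordinate reading (R1)/(M1) of `B11Prop9Model` / `B11Eq181AnalyticExtension` («Gᶜ-valued small configurations» = an
open set of the ambient bond-algebra power; the conjugations V(y,y′) ↦ v(y)V(y,y′)v(y′)⁻¹ are continuous linear, hence analytic, maps of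
that space — the hypotheses `hX`, `hY` of `analyticOnNhd_orbitExt`); the lattice objects U_k, V^v, U^{v̄} are NOT constructed here.
(ii) NOT TYPED SEPARATELY (commentary or covered by a cited decl, said where above): p. 305 `L9–12` «we are interested more in this
expansion than in an analyticity property … This is one of the main steps in our procedure»; p. 306 `L17–21` («more general and natural
condition», «Q̃ instead of Q, or mix»); p. 306 `L32` («better regularity properties»); p. 307 `L20` «We will use these statements in a
subsequent paper»; p. 308 `L18–24` (the omission paragraph, quoted in `B11SectG.Ineq189`'s docstring).  (iii) The clause p. 305 `L33`
«𝒜₁ satisfies … the regularity conditions (19) with ε₂ = 8B₅ε₁» is NOT given a hypothesis-form def: no carrier of record has the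
(19)-size of the FIELD 𝒜₁ at the minimal background (`B11.LGData.In19_21` is a predicate on configurations U₁ = e^{iηA}); it is the
radius ε₄ = 8ε₂ of the space (115) in which Proposition 6 places the solution (p. 296; `B11.axial_critical_from_one_landau`,
`B11.Prop6Printed`, `B11Eq174Chart.Regime`, model radius `B11Prop9Model.lam`), cited above.  (iv) (189) is not proved anywhere
(G-B11-G2); the «same properties as Δ_a⁻¹» second-order entries (G-B11-G1), «All the above considerations … valid for this function
also» beyond the scheme level (G-B11-G3) and «finally Proposition 2 and (181)» beyond the typed transports (G-B11-G2a) are the cell's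
located by-reference steps — inherited, not re-adjudicated.  (v) The bundle conjoins statements over three unrelated carrier groups
(`fam`; `bN, b3, nMax, d2V`; `Γ, dom, Uk`) exactly as print states them side by side; no law linking them is asserted (a node prover
instantiates each at its objects, cf. `Node00/CarriersZSectG.SectGPres` for the Prop. 9 slot).  (vi) No instance, no notation, no
`sorry`; axioms standard (`propext`, `Classical.choice`, `Quot.sound`); 0 new unproved facts beyond the three hypothesis-form `…Printed`
statements of print (`Ineq189ForallPrinted`, `Cov181OnDomPrinted`, `OrbitExtensionPrinted` — the last PROVED from the second).  Nothing
here proves a summit statement or bears on the Clay problem; the node count does not move.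
-/

noncomputable section

namespace Literature.MathematicalPhysics.QuantumFieldTheory.Balaban1983to89.B11Carve16SectGHyp

open Set
open Literature.MathematicalPhysics.QuantumFieldTheory.Balaban1983to89
open B11SectG

/-! ## §1 (173): print's constant `B₅ = 6B₁B₃C₁` -/

/-- **(173)** p. 305 [PDF 29] (`p0029.txt:L27–28`), verbatim: *"ε₂ = B₁(B₃(1 + 4C₁)ε₁ + C₁ε₁) ≤ 6B₁B₃C₁ε₁ = B₅ε₁. (173)
We assume that C₁ is an absolute constant, hence B₅ is such a constant also."* — print's DEFINITION of the constant B₅ (B₁ =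
the constant of [6] Thm 2 / Prop. 3, `B11.B1_eq_B8Prop3`; B₃ = (162), `B11B3.Claim162`; C₁ of (14)/(172), «C₁ = L³» p. 280).
The typed Proposition 9 of record `B11.Prop9Printed B₅ C₁ β₀ δ₀ fam` takes B₅ as a parameter fixed BEFORE the family (= «B₅
is such a constant also»); this definition names print's value of that parameter.  (The Sect. E–G model `B11Prop9Model` works
with its own `B11Prop9Model.B5 = 2(λ + α)` and covers any larger B₅ by `prop9Printed_model_of_le` — a different, model-level
quantity.) [cite: Balaban1985Variational, (173) p.305] -/
def constB5 (B₁ B₃ C₁ : ℝ) : ℝ :=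
  6 * B₁ * B₃ * C₁

/-- Unfolding. [cite: Balaban1985Variational, (173) p.305] -/
theorem constB5_def (B₁ B₃ C₁ : ℝ) : constB5 B₁ B₃ C₁ = 6 * B₁ * B₃ * C₁ := rfl

/-- B₅ > 0 for positive B₁, B₃, C₁. [cite: Balaban1985Variational, (173) p.305 (arithmetic)] -/
theorem constB5_pos {B₁ B₃ C₁ : ℝ} (hB₁ : 0 < B₁) (hB₃ : 0 < B₃) (hC₁ : 0 < C₁) : 0 < constB5 B₁ B₃ C₁ := by
  unfold constB5; positivity

/-- **The inequality (173) at print's B₅** — kernel bookkeeping: `B11.ineq173` (row B11.Eq172, PROVED in `…B11`) read with the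
named constant: ε₂ = B₁(B₃(1 + 4C₁)ε₁ + C₁ε₁) ≤ B₅ε₁ for B₃, C₁ ≥ 1, B₁, ε₁ ≥ 0. [cite: Balaban1985Variational, (173) p.305] -/
theorem eps2_le_constB5_mul (B₁ B₃ C₁ ε₁ : ℝ) (hB₁ : 0 ≤ B₁) (hB₃ : 1 ≤ B₃) (hC₁ : 1 ≤ C₁) (hε₁ : 0 ≤ ε₁) :
    B₁ * (B₃ * (1 + 4 * C₁) * ε₁ + C₁ * ε₁) ≤ constB5 B₁ B₃ C₁ * ε₁ := by
  unfold constB5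
  exact B11.ineq173 B₁ B₃ C₁ ε₁ hB₁ hB₃ hC₁ hε₁

/-! ## §2 (189) with its printed quantifier clause «for … A′ satisfying (77)» and the printed constant O(1)ε₃ -/

section Ineq189

variable {g : B6.Geometry}
variable {FA F3 : Type} [AddCommGroup FA] [Module ℝ FA] [AddCommGroup F3] [Module ℝ F3]

/-- **(189) FOR ALL A′ SATISFYING (77)** (p. 308 [PDF 32], `p0032.txt:L24–28`, verbatim: *"We have |Δ(y)((δ²/δA′²)V)(A′)𝔄| ≤
O(1)ε₃(Lʲη)⁻³ exp(−¼δ₀d(y, y′)) max{|𝔄|_{(−1)}, |∇𝔄|_{(−2)}}, (189) for supp 𝔄 ⊂ Δ̃(y′), A′ satisfying (77), y ∈ Λ_j."*; p. 307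
[PDF 31] `p0031.txt:L37–38`: *"For a configuration A′ satisfying (77) with ε₃ sufficiently small we have …"*; (77) p. 290 =
max{|A′|_{(−1)}, |∇A′|_{(−2)}} < ε₃) — the ROW DECL OF RECORD `B11SectG.Ineq189 bN b3 W θW δ₀` (row B11.Eq189, typed: the majorant
θ_W·e^{−¼δ₀d(y,y′)} of ONE linear kernel W, «typed at A′ = 𝒜₀ + H₀B (the only instance (184) uses)») UNDER PRINT'S BINDERS: one
absolute O(1) and one threshold («ε₃ sufficiently small») chosen BEFORE ε₃ and A′, the bound LINEAR in ε₃ and valid for EVERY A′ in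
the ball (77) — the kernel family `d2V A′ = ((δ²/δA′²)V)(A′)` «treated as a kernel of a linear operator» (p. 307), the size
`nMax A′ = max{|A′|_{(−1)}, |∇A′|_{(−2)}}` (the carrier letter `B11.LGData.nMax` at model level) supplied as explicit parameters.
The model-level twin is the located leaf `B11Prop9Model.SectGDatum.Letters.maj189` (∀ Y in the ball a₃, fixed θ_W).  NOT PROVED here or
anywhere in print (*"We do not perform these calculations here …"*, `p0032.txt:L22–24`; cell GAPS G-B11-G2; supplied term census
`B11Ineq189`). [cite: Balaban1985Variational, (189) p.308] -/
def Ineq189ForallPrinted (bN : BlockNorm g FA) (b3 : BlockNorm g F3) (nMax : FA → ℝ) (d2V : FA → (FA →ₗ[ℝ] F3))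
    (δ₀ : ℝ) : Prop :=
  ∃ O₁ a₃ : ℝ, 0 < O₁ ∧ 0 < a₃ ∧ ∀ ε₃ : ℝ, 0 < ε₃ → ε₃ ≤ a₃ →
    ∀ A' : FA, nMax A' < ε₃ → Ineq189 bN b3 (d2V A') (O₁ * ε₃) δ₀

/-- Unfolding. [cite: Balaban1985Variational, (189) p.308] -/
theorem ineq189ForallPrinted_iff (bN : BlockNorm g FA) (b3 : BlockNorm g F3) (nMax : FA → ℝ) (d2V : FA → (FA →ₗ[ℝ] F3))
    (δ₀ : ℝ) :
    Ineq189ForallPrinted bN b3 nMax d2V δ₀ ↔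
      ∃ O₁ a₃ : ℝ, 0 < O₁ ∧ 0 < a₃ ∧ ∀ ε₃ : ℝ, 0 < ε₃ → ε₃ ≤ a₃ →
        ∀ A' : FA, nMax A' < ε₃ → Ineq189 bN b3 (d2V A') (O₁ * ε₃) δ₀ :=
  Iff.rfl

/-- **The instance of record**: under the printed binders, at every A′ of the ball (77) the row decl `B11SectG.Ineq189` holds for the
kernel `d2V A′` with θ_W = O(1)·a₃ — the shape of the model's located leaf `B11Prop9Model.SectGDatum.Letters.maj189` (one θ_W on the
whole ball). [cite: Balaban1985Variational, (189) p.308 (bookkeeping)] -/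
theorem Ineq189ForallPrinted.on_ball {bN : BlockNorm g FA} {b3 : BlockNorm g F3} {nMax : FA → ℝ}
    {d2V : FA → (FA →ₗ[ℝ] F3)} {δ₀ : ℝ} (h : Ineq189ForallPrinted bN b3 nMax d2V δ₀) :
    ∃ θW a₃ : ℝ, 0 < θW ∧ 0 < a₃ ∧ ∀ A' : FA, nMax A' < a₃ → Ineq189 bN b3 (d2V A') θW δ₀ := by
  obtain ⟨O₁, a₃, hO₁, ha₃, H⟩ := h
  exact ⟨O₁ * a₃, a₃, mul_pos hO₁ ha₃, ha₃, fun A' hA' => H a₃ ha₃ le_rfl A' hA'⟩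

/-- Monotonicity of the row decl in its constant (used to compare the O(1)ε₃ of (189) at two radii): a majorant θe^{−¼δ₀d} is also a
majorant θ′e^{−¼δ₀d} for θ ≤ θ′. [cite: Balaban1985Variational, (189) p.308 (bookkeeping)] -/
theorem ineq189_mono {bN : BlockNorm g FA} {b3 : BlockNorm g F3} {W : FA →ₗ[ℝ] F3} {θ θ' δ₀ : ℝ} (hθ : θ ≤ θ')
    (h : Ineq189 bN b3 W θ δ₀) : Ineq189 bN b3 W θ' δ₀ :=
  HasMaj.mono h fun _ _ => mul_le_mul_of_nonneg_right hθ (Real.exp_nonneg _)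

/-- At a smaller radius the printed bound only improves: for A′ with `nMax A′ < ε₃ ≤ ε₃′ ≤ a₃` the kernel `d2V A′` has the majorant
with constant O(1)ε₃ and hence with O(1)ε₃′. [cite: Balaban1985Variational, (189) p.308 (bookkeeping)] -/
theorem Ineq189ForallPrinted.at_le {bN : BlockNorm g FA} {b3 : BlockNorm g F3} {nMax : FA → ℝ}
    {d2V : FA → (FA →ₗ[ℝ] F3)} {δ₀ : ℝ} (h : Ineq189ForallPrinted bN b3 nMax d2V δ₀) :
    ∃ O₁ a₃ : ℝ, 0 < O₁ ∧ 0 < a₃ ∧ ∀ ε₃ ε₃' : ℝ, 0 < ε₃ → ε₃ ≤ ε₃' → ε₃' ≤ a₃ →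
      ∀ A' : FA, nMax A' < ε₃ → Ineq189 bN b3 (d2V A') (O₁ * ε₃') δ₀ := by
  obtain ⟨O₁, a₃, hO₁, ha₃, H⟩ := h
  refine ⟨O₁, a₃, hO₁, ha₃, fun ε₃ ε₃' hε₃ hle hle' A' hA' => ?_⟩
  exact ineq189_mono (mul_le_mul_of_nonneg_left hle hO₁.le) (H ε₃ hε₃ (hle.trans hle') A' hA')

end Ineq189

/-! ## §3 p. 307: (181) on the analyticity domain, and the extension of U_k to all orbits «treating the equality as a definition» -/

section Orbit

variable (Γ : Type*) {X Y : Type*} [Group Γ] [MulAction Γ X] [MulAction Γ Y]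

/-- **The union of the orbits through the analyticity domain** (p. 307 [PDF 31] `p0031.txt:L17–19`, verbatim: *"Thus U_k(V) is defined
on all orbits of the group of Gᶜ-valued transformations, which contain elements V = V′V₀ described before."*): the set of data V some
gauge transform of which lies in the domain `dom` (= the configurations V′V₀ of (172)).  Abstract: a group `Γ` (the Gᶜ-valued gauge
transformations v on 𝔅_k) acting on the data (V ↦ V^v). [cite: Balaban1985Variational, p.307 l.17–19] -/
def orbitUnion (dom : Set X) : Set X :=
  {V | ∃ γ : Γ, γ • V ∈ dom}

variable {Γ}

/-- Membership, unfolded. [cite: Balaban1985Variational, p.307 l.17–19] -/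
theorem mem_orbitUnion {dom : Set X} {V : X} : V ∈ orbitUnion Γ dom ↔ ∃ γ : Γ, γ • V ∈ dom := Iff.rfl

/-- The domain lies in the union of its orbits (γ = 1). [cite: Balaban1985Variational, p.307 l.17–19] -/
theorem mem_orbitUnion_of_mem {dom : Set X} {V : X} (hV : V ∈ dom) : V ∈ orbitUnion Γ dom :=
  ⟨1, by rwa [one_smul]⟩

/-- The union of orbits is invariant. [cite: Balaban1985Variational, p.307 l.17–19] -/
theorem smul_mem_orbitUnion {dom : Set X} {V : X} (hV : V ∈ orbitUnion Γ dom) (δ : Γ) : δ • V ∈ orbitUnion Γ dom := by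
  obtain ⟨γ, hγ⟩ := hV
  exact ⟨γ * δ⁻¹, by rwa [mul_smul, inv_smul_smul]⟩

/-- Invariance as an equivalence. [cite: Balaban1985Variational, p.307 l.17–19] -/
theorem smul_mem_orbitUnion_iff {dom : Set X} {V : X} (δ : Γ) : δ • V ∈ orbitUnion Γ dom ↔ V ∈ orbitUnion Γ dom :=
  ⟨fun h => by simpa using smul_mem_orbitUnion h δ⁻¹, fun h => smul_mem_orbitUnion h δ⟩

variable (Γ)

/-- **(181) ON THE ANALYTICITY DOMAIN** (p. 307 [PDF 31] `p0031.txt:L10–16`, verbatim: *"For the minimal configurations in the axial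
gauge we have U_k(V^v) = U_k(V)^{v̄}, (181) where v̄ is constant on blocks Bʲ(y), y ∈ Λ_j, and equal to v(y). This equality extends by
analyticity to Gᶜ-valued configurations V described above, and then, again by analyticity, to Gᶜ-valued gauge transformations v in a
small neighborhood of G-valued transformations. This means that we can prove the equality (181) for all these v for which V^v is in the
analyticity domain of U_k."*) — HYPOTHESIS FORM over an abstract action: `Γ` acts on the data `X` (V ↦ V^v) and on the configurations
`Y` (U ↦ U^{v̄}; the block-constant lift v ↦ v̄ is `B15Eq177GaugeInvariance.blockLift` on the torus carrier), `dom ⊆ X` is the analyticity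
domain, `Uk : X → Y` the (extended) minimal configuration; the statement: (181) holds whenever V and V^v both lie in `dom`.  IN TREE
(cited, not restated): the G-valued case is PROVED abstractly as `B11Eq181Covariance.minimiser_smul` (invariant functional + unique
constrained minimiser ⇒ equivariance; here `cov181OnDom_of_minimiser`), the step «extends by analyticity» is PROVED as the real-slice
identity principle `B11Eq181AnalyticExtension.eq181_extends_by_analyticity`; the opaque clause of record is `B11.AnData.ExtOrbits`
inside `B11.Prop9Printed`. [cite: Balaban1985Variational, (181) p.307 l.10–16] -/
def Cov181OnDomPrinted (dom : Set X) (Uk : X → Y) : Prop :=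
  ∀ (γ : Γ) (V : X), V ∈ dom → γ • V ∈ dom → Uk (γ • V) = γ • Uk V

variable {Γ}

/-- The G-valued case feeds the hypothesis: an everywhere-defined EQUIVARIANT selection (the conclusion of
`B11Eq181Covariance.minimiser_smul`, row B11.Eq181) satisfies (181) on every domain. [cite: Balaban1985Variational, (181) p.307 (bookkeeping)] -/
theorem cov181OnDom_of_equivariant {Uk : X → Y} (h : ∀ (γ : Γ) (V : X), Uk (γ • V) = γ • Uk V) (dom : Set X) :
    Cov181OnDomPrinted Γ dom Uk :=
  fun γ V _ _ => h γ V

open scoped Pointwise in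
/-- **JUNCTION to row B11.Eq181**: for an invariant functional `f`, equivariant admissible sets `S` and a selection `sel` of UNIQUE
constrained minimisers (Theorem 1 + the axial gauge), `B11Eq181Covariance.minimiser_smul` gives (181) for all (G-valued) gauge
transformations, hence `Cov181OnDomPrinted` on any domain. [cite: Balaban1985Variational, (181) p.307 (bookkeeping)] -/
theorem cov181OnDom_of_minimiser {D : Type*} [MulAction Γ D] {f : Y → ℝ} (hf : ∀ (γ : Γ) (x : Y), f (γ • x) = f x)
    {S : D → Set Y} (hS : ∀ (γ : Γ) (V : D), S (γ • V) = γ • S V) (sel : D → Y) (hmem : ∀ V, sel V ∈ S V)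
    (hmin : ∀ V, IsMinOn f (S V) (sel V)) (huniq : ∀ (V : D) (u : Y), u ∈ S V → IsMinOn f (S V) u → u = sel V)
    (dom : Set D) : Cov181OnDomPrinted Γ dom sel :=
  cov181OnDom_of_equivariant (fun γ V => B11Eq181Covariance.minimiser_smul hf hS sel hmem hmin huniq γ V) dom

/-- Well-definedness of the orbit extension (the content of «treating the equality as a definition»): under (181) on the domain, two
ways of moving V into the domain give the same transported value. [cite: Balaban1985Variational, p.307 l.16–17] -/
theorem inv_smul_apply_eq_of_cov181 {dom : Set X} {Uk : X → Y} (hcov : Cov181OnDomPrinted Γ dom Uk) {V : X} {γ δ : Γ}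
    (hγ : γ • V ∈ dom) (hδ : δ • V ∈ dom) : γ⁻¹ • Uk (γ • V) = δ⁻¹ • Uk (δ • V) := by
  have hmove : (δ * γ⁻¹) • (γ • V) = δ • V := by rw [mul_smul, inv_smul_smul]
  have h := hcov (δ * γ⁻¹) (γ • V) hγ (by rwa [hmove])
  rw [hmove] at h
  rw [h, smul_smul, inv_mul_cancel_left]

open Classical in
/-- **THE EXTENSION OF U_k TO ALL ORBITS** (p. 307 [PDF 31] `p0031.txt:L16–17`, verbatim: *"We can extend it to all Gᶜ-valued v treating
the equality as a definition for the remaining v."*) — a definition with body: on the union of orbits move V into the domain by some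
γ and transport the value back, `γ⁻¹ • Uk (γ • V)`; off the union (where print defines nothing) the junk value `Uk V`.  Independent of
the choice of γ under `Cov181OnDomPrinted` (`orbitExt_apply_of_smul_mem`). [cite: Balaban1985Variational, p.307 l.16–17] -/
def orbitExt (Γ : Type*) [Group Γ] [MulAction Γ X] [MulAction Γ Y] (dom : Set X) (Uk : X → Y) : X → Y := fun V =>
  if h : ∃ γ : Γ, γ • V ∈ dom then h.choose⁻¹ • Uk (h.choose • V) else Uk V

/-- The extension computed with ANY γ moving V into the domain. [cite: Balaban1985Variational, p.307 l.16–17] -/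
theorem orbitExt_apply_of_smul_mem {dom : Set X} {Uk : X → Y} (hcov : Cov181OnDomPrinted Γ dom Uk) {V : X} {γ : Γ}
    (hγ : γ • V ∈ dom) : orbitExt Γ dom Uk V = γ⁻¹ • Uk (γ • V) := by
  classical
  have h : ∃ γ : Γ, γ • V ∈ dom := ⟨γ, hγ⟩
  unfold orbitExt
  rw [dif_pos h]
  exact inv_smul_apply_eq_of_cov181 hcov h.choose_spec hγ

/-- **The extension EXTENDS**: on the analyticity domain it is U_k (γ = 1). [cite: Balaban1985Variational, p.307 l.16–19] -/
theorem orbitExt_eq_of_mem {dom : Set X} {Uk : X → Y} (hcov : Cov181OnDomPrinted Γ dom Uk) {V : X} (hV : V ∈ dom) :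
    orbitExt Γ dom Uk V = Uk V := by
  have h1 : (1 : Γ) • V ∈ dom := by rwa [one_smul]
  rw [orbitExt_apply_of_smul_mem hcov h1, one_smul, inv_one, one_smul]

/-- `Set.EqOn` form of `orbitExt_eq_of_mem`. [cite: Balaban1985Variational, p.307 l.16–19] -/
theorem orbitExt_eqOn {dom : Set X} {Uk : X → Y} (hcov : Cov181OnDomPrinted Γ dom Uk) : EqOn (orbitExt Γ dom Uk) Uk dom :=
  fun _ hV => orbitExt_eq_of_mem hcov hV

/-- **«and it satisfies (181)»** (p. 307 `p0031.txt:L19–20`): the extension is covariant under EVERY γ on the union of orbits.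
[cite: Balaban1985Variational, (181) p.307 l.19–20] -/
theorem orbitExt_smul {dom : Set X} {Uk : X → Y} (hcov : Cov181OnDomPrinted Γ dom Uk) {V : X} (hV : V ∈ orbitUnion Γ dom)
    (δ : Γ) : orbitExt Γ dom Uk (δ • V) = δ • orbitExt Γ dom Uk V := by
  obtain ⟨γ, hγ⟩ := hV
  have hmove : (γ * δ⁻¹) • (δ • V) = γ • V := by rw [mul_smul, inv_smul_smul]
  have hγ' : (γ * δ⁻¹) • (δ • V) ∈ dom := by rwa [hmove]
  rw [orbitExt_apply_of_smul_mem hcov hγ', orbitExt_apply_of_smul_mem hcov hγ, hmove, mul_inv_rev, inv_inv, mul_smul]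

/-- Off the domain the two transports agree: the extension on the orbit union is FORCED — any map that agrees with U_k on the domain
and satisfies (181) on the union of orbits coincides there with `orbitExt` («treating the equality as a definition» loses nothing).
[cite: Balaban1985Variational, p.307 l.16–19] -/
theorem eqOn_orbitExt_of_covariant {dom : Set X} {Uk Uext : X → Y} (hcov : Cov181OnDomPrinted Γ dom Uk)
    (hagree : EqOn Uext Uk dom) (hcovU : ∀ (δ : Γ) (V : X), V ∈ orbitUnion Γ dom → Uext (δ • V) = δ • Uext V) :
    EqOn Uext (orbitExt Γ dom Uk) (orbitUnion Γ dom) := by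
  intro V hV
  obtain ⟨γ, hγ⟩ := hV
  have h1 : Uext (γ • V) = γ • Uext V := hcovU γ V ⟨γ, hγ⟩
  have h2 : Uext V = γ⁻¹ • Uext (γ • V) := by rw [h1, inv_smul_smul]
  rw [h2, hagree hγ, orbitExt_apply_of_smul_mem hcov hγ]

/-- The union of orbits of an OPEN domain under a continuously acting group is open (a union of preimages of `dom` under the maps
V ↦ γ • V) — the implicit first half of «It is an analytic function on the union of the set of orbits» (p. 307 `p0031.txt:L19`:
analyticity is asserted on an open set). [cite: Balaban1985Variational, p.307 l.17–19 (bookkeeping)] -/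
theorem isOpen_orbitUnion [TopologicalSpace X] {dom : Set X} (hdom : IsOpen dom)
    (hX : ∀ (γ : Γ) (x : X), ContinuousAt (fun x : X => γ • x) x) : IsOpen (orbitUnion Γ dom) := by
  have hrepr : orbitUnion Γ dom = ⋃ γ : Γ, (fun x : X => γ • x) ⁻¹' dom := by
    ext V
    simp [orbitUnion]
  rw [hrepr]
  exact isOpen_iUnion fun γ => hdom.preimage (continuous_iff_continuousAt.2 (hX γ))

section Analytic

variable [NormedAddCommGroup X] [NormedSpace ℂ X] [NormedAddCommGroup Y] [NormedSpace ℂ Y]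

/-- **«It is an analytic function on the union of the set of orbits»** (p. 307 [PDF 31] `p0031.txt:L19`): if U_k is analytic on the
(open) analyticity domain, the actions V ↦ V^v on the data and U ↦ U^{v̄} on the configurations are analytic maps (on the lattice:
bondwise conjugations, continuous and linear in the ambient bond algebra — reading (R1) of `B11Prop9Model`), and (181) holds on the
domain, then the orbit extension is analytic at every point of the union of orbits: near V with γ • V ∈ dom it IS the composition
(γ⁻¹ • ·) ∘ U_k ∘ (γ • ·). [cite: Balaban1985Variational, p.307 l.19] -/
theorem analyticOnNhd_orbitExt {dom : Set X} {Uk : X → Y} (hdom : IsOpen dom) (hU : AnalyticOnNhd ℂ Uk dom)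
    (hX : ∀ (γ : Γ) (x : X), AnalyticAt ℂ (fun x : X => γ • x) x)
    (hY : ∀ (γ : Γ) (y : Y), AnalyticAt ℂ (fun y : Y => γ • y) y) (hcov : Cov181OnDomPrinted Γ dom Uk) :
    AnalyticOnNhd ℂ (orbitExt Γ dom Uk) (orbitUnion Γ dom) := by
  intro V hV
  obtain ⟨γ, hγ⟩ := hV
  -- the open piece {V′ : γ • V′ ∈ dom} of the union of orbits containing V
  have hS : IsOpen ((fun x : X => γ • x) ⁻¹' dom) :=
    hdom.preimage (continuous_iff_continuousAt.2 fun x => (hX γ x).continuousAt)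
  have hmem : V ∈ (fun x : X => γ • x) ⁻¹' dom := hγ
  -- on that piece the extension is the analytic composition (γ⁻¹ • ·) ∘ Uk ∘ (γ • ·)
  have h12 : AnalyticAt ℂ (fun x : X => Uk (γ • x)) V := (hU (γ • V) hγ).comp (hX γ V)
  have hcomp : AnalyticAt ℂ (fun x : X => γ⁻¹ • Uk (γ • x)) V :=
    AnalyticAt.comp (g := fun y : Y => γ⁻¹ • y) (f := fun x : X => Uk (γ • x)) (hY γ⁻¹ (Uk (γ • V))) h12
  refine hcomp.congr (Filter.eventuallyEq_of_mem (hS.mem_nhds hmem) fun x hx => ?_)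
  exact (orbitExt_apply_of_smul_mem hcov hx).symm

variable (Γ)

/-- **THE ORBIT STATEMENT OF p. 307** (`p0031.txt:L16–20`, verbatim: *"We can extend it to all Gᶜ-valued v treating the equality as a
definition for the remaining v. Thus U_k(V) is defined on all orbits of the group of Gᶜ-valued transformations, which contain elements
V = V′V₀ described before. It is an analytic function on the union of the set of orbits, and it satisfies (181). We will use these
statements in a subsequent paper."*) — HYPOTHESIS FORM: there is a map on the data which (a) agrees with U_k on the analyticity domain,
(b) satisfies (181) for every gauge transformation on the union of the orbits through the domain, (c) is analytic there.  This is
the clause «It can be extended further to all orbits of such configurations V′V₀ by the equality (181)» of Proposition 9 (opaque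
field `B11.AnData.ExtOrbits` of the typed statement of record `B11.Prop9Printed`; read in the model `B11Prop9Model` (R3) as the
identity principle only — the orbit-level content is typed HERE and PROVED from (181)-on-the-domain in
`orbitExtensionPrinted_of_cov181OnDom`). [cite: Balaban1985Variational, p.307 l.16–20; Prop. 9 p.309] -/
def OrbitExtensionPrinted (dom : Set X) (Uk : X → Y) : Prop :=
  ∃ Uext : X → Y, EqOn Uext Uk dom ∧
    (∀ (δ : Γ) (V : X), V ∈ orbitUnion Γ dom → Uext (δ • V) = δ • Uext V) ∧
    AnalyticOnNhd ℂ Uext (orbitUnion Γ dom)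

variable {Γ}

/-- **p. 307 l. 16–20 PROVED from (181) on the domain** (kernel-checked, Mathlib only): for an open analyticity domain on which U_k is
analytic, analytic actions, and (181) on the domain (`Cov181OnDomPrinted` — itself the conclusion of rows B11.Eq181's
`B11Eq181Covariance.minimiser_smul` + `B11Eq181AnalyticExtension.eq181_extends_by_analyticity`), the orbit statement holds, witnessed
by `orbitExt`. [cite: Balaban1985Variational, p.307 l.16–20] -/
theorem orbitExtensionPrinted_of_cov181OnDom {dom : Set X} {Uk : X → Y} (hdom : IsOpen dom) (hU : AnalyticOnNhd ℂ Uk dom)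
    (hX : ∀ (γ : Γ) (x : X), AnalyticAt ℂ (fun x : X => γ • x) x)
    (hY : ∀ (γ : Γ) (y : Y), AnalyticAt ℂ (fun y : Y => γ • y) y) (hcov : Cov181OnDomPrinted Γ dom Uk) :
    OrbitExtensionPrinted Γ dom Uk :=
  ⟨orbitExt Γ dom Uk, orbitExt_eqOn hcov, fun δ _ hV => orbitExt_smul hcov hV δ,
    analyticOnNhd_orbitExt hdom hU hX hY hcov⟩

end Analytic

end Orbit

/-! ## §4 The bundle of block 16 (Sect. G, pp. 305–309) keyed to the consumer -/

/-- **BLOCK 16 OF [Balaban1985Variational] IN HYPOTHESIS FORM** — Sect. G conjoined BY NAME: **Proposition 9** p. 309 («Let us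
formulate the results of this section.», `p0033.txt:L7`) as the typed statement of record `B11.Prop9Printed B₅ C₁ β₀ δ₀ fam` over the
Sect. G carrier family `fam : I → B11.AnData` (its clauses: analytic extension in V′ (172), extension to orbits (181), 𝓗 determined
by (174)–(175) or (179)–(180), analytic in B, (19)–(21) with ε₂ = B₅ε₁ (173), the decay (190) of the derivative (182)); **(189)** —
the one displayed bound of the section that print states without proof — in its printed generality (`Ineq189ForallPrinted`, built on
the row decl `B11SectG.Ineq189`) for the second-derivative kernel family `d2V` of one background, with the SAME decay rate δ₀; and the
two sentences of p. 307 about (181): on the analyticity domain (`Cov181OnDomPrinted`) and on the union of orbits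
(`OrbitExtensionPrinted`), over one abstract gauge action `Γ` on data `X` ∋ `dom` and configurations `Y`.  The PROVED rows of these
pages ((170)–(171), (172), (173), (176)–(177), (178)–(180), (182)–(188), (190) from (189); header § IN TREE) need no slot.  A node
prover takes `(h : Hyp B₅ C₁ β₀ δ₀ fam bN b3 nMax d2V Γ dom Uk)`; `Hyp.of_cov181OnDom` builds the last field from the third.
[cite: Balaban1985Variational, Prop. 9 p.309 + (189) p.308 + (181) p.307 (bundle by name)] -/
structure Hyp {I : Type} (B₅ C₁ β₀ δ₀ : ℝ) (fam : I → B11.AnData)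
    {g : B6.Geometry} {FA F3 : Type} [AddCommGroup FA] [Module ℝ FA] [AddCommGroup F3] [Module ℝ F3]
    (bN : BlockNorm g FA) (b3 : BlockNorm g F3) (nMax : FA → ℝ) (d2V : FA → (FA →ₗ[ℝ] F3))
    (Γ : Type) {X Y : Type} [Group Γ] [MulAction Γ X] [MulAction Γ Y]
    [NormedAddCommGroup X] [NormedSpace ℂ X] [NormedAddCommGroup Y] [NormedSpace ℂ Y]
    (dom : Set X) (Uk : X → Y) : Prop where
  /-- **Proposition 9** (p. 309 [PDF 33] `p0033.txt:L8–16`) — `B11.Prop9Printed`, by name. [cite: Balaban1985Variational, Prop. 9 p.309] -/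
  prop9 : B11.Prop9Printed B₅ C₁ β₀ δ₀ fam
  /-- **(189)** (p. 308 [PDF 32] `p0032.txt:L24–28`) for all A′ of the ball (77), constant O(1)ε₃ — `Ineq189ForallPrinted` (§2) on the
  row decl `B11SectG.Ineq189`. [cite: Balaban1985Variational, (189) p.308] -/
  ineq189 : Ineq189ForallPrinted bN b3 nMax d2V δ₀
  /-- **(181) on the analyticity domain** (p. 307 [PDF 31] `p0031.txt:L14–16`) — `Cov181OnDomPrinted` (§3). [cite: Balaban1985Variational, (181) p.307 l.14–16] -/
  cov181 : Cov181OnDomPrinted Γ dom Uk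
  /-- **U_k on the union of orbits**: extends U_k, satisfies (181), analytic there (p. 307 [PDF 31] `p0031.txt:L16–20`) —
  `OrbitExtensionPrinted` (§3). [cite: Balaban1985Variational, p.307 l.16–20] -/
  orbitExt : OrbitExtensionPrinted Γ dom Uk

namespace Hyp

variable {I : Type} {B₅ C₁ β₀ δ₀ : ℝ} {fam : I → B11.AnData}
  {g : B6.Geometry} {FA F3 : Type} [AddCommGroup FA] [Module ℝ FA] [AddCommGroup F3] [Module ℝ F3]
  {bN : BlockNorm g FA} {b3 : BlockNorm g F3} {nMax : FA → ℝ} {d2V : FA → (FA →ₗ[ℝ] F3)}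
  {Γ X Y : Type} [Group Γ] [MulAction Γ X] [MulAction Γ Y]
  [NormedAddCommGroup X] [NormedSpace ℂ X] [NormedAddCommGroup Y] [NormedSpace ℂ Y]
  {dom : Set X} {Uk : X → Y}

/-- **Constructor with the orbit field DERIVED**: Proposition 9 + (189) + (181) on an open analyticity domain on which U_k is analytic,
with analytic actions, give the bundle (`orbitExtensionPrinted_of_cov181OnDom`). [cite: Balaban1985Variational, Prop. 9 p.309 + p.307 l.16–20 (bookkeeping)] -/
theorem of_cov181OnDom (h9 : B11.Prop9Printed B₅ C₁ β₀ δ₀ fam) (h189 : Ineq189ForallPrinted bN b3 nMax d2V δ₀)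
    (hcov : Cov181OnDomPrinted Γ dom Uk) (hdom : IsOpen dom) (hU : AnalyticOnNhd ℂ Uk dom)
    (hX : ∀ (γ : Γ) (x : X), AnalyticAt ℂ (fun x : X => γ • x) x)
    (hY : ∀ (γ : Γ) (y : Y), AnalyticAt ℂ (fun y : Y => γ • y) y) :
    Hyp B₅ C₁ β₀ δ₀ fam bN b3 nMax d2V Γ dom Uk :=
  ⟨h9, h189, hcov, orbitExtensionPrinted_of_cov181OnDom hdom hU hX hY hcov⟩

/-- Accessor in the shape consumers of row B11.Eq189 read: one θ_W on the whole ball (77). [cite: Balaban1985Variational, (189) p.308 (bookkeeping)] -/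
theorem ineq189_on_ball (h : Hyp B₅ C₁ β₀ δ₀ fam bN b3 nMax d2V Γ dom Uk) :
    ∃ θW a₃ : ℝ, 0 < θW ∧ 0 < a₃ ∧ ∀ A' : FA, nMax A' < a₃ → Ineq189 bN b3 (d2V A') θW δ₀ :=
  h.ineq189.on_ball

/-- The orbit extension of the bundle is `orbitExt` (uniqueness on the union of orbits). [cite: Balaban1985Variational, p.307 l.16–19 (bookkeeping)] -/
theorem orbitExt_unique (h : Hyp B₅ C₁ β₀ δ₀ fam bN b3 nMax d2V Γ dom Uk) {Uext : X → Y} (hagree : EqOn Uext Uk dom)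
    (hcovU : ∀ (δ : Γ) (V : X), V ∈ orbitUnion Γ dom → Uext (δ • V) = δ • Uext V) :
    EqOn Uext (B11Carve16SectGHyp.orbitExt Γ dom Uk) (orbitUnion Γ dom) :=
  eqOn_orbitExt_of_covariant h.cov181 hagree hcovU

end Hyp

end Literature.MathematicalPhysics.QuantumFieldTheory.Balaban1983to89.B11Carve16SectGHyp

end
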